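import Mathlib
import Literature.Barriers.ValiantsHypothesis.AlgebraicNaturalProofs
import Literature.Computability.AlgebraicComplexity.StandardFamilies
import Literature.Computability.AlgebraicComplexity.DetInVP
import Literature.Computability.AlgebraicComplexity.ArithCircuitProofs
import Literature.Barriers.Schanuel.NesterenkoModularScopeMeasurePolys
import Summits.ValiantsHypothesis.ValiantsHypothesis.Theorems.BarrierLeverSuccinctHittingSetsForVPRazDeterminant
import Summits.ValiantsHypothesis.ValiantsHypothesis.Theorems.BarrierLeverSuccinctHittingSetsForVPDimensionCount
import HarnessLib

/-!
# Crux `BarrierLever.SuccinctHittingSetsForVP` (stmt-ValiantsHypothesis-14610), line `registered` —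
stub `stub_partitionDeterminantLevel`: NISAN'S PARTITION DETERMINANTS ARE LEVEL-8 DISTINGUISHERS
(Berkowitz)

**What is proved (unconditional; it does NOT close the item).** Fix `n ≥ 10`, `2h ≤ n`, the ROW
monomials `p` (supported on `x_0 … x_(h-1)`, `2|p| ≤ n`), the COLUMN monomials `q` (supported on
`x_h … x_(2h-1)`, `2|q| ≤ n`) and a bijection `e : rows ≃ columns`. The square partition coefficient
matrix `[coeff_(p + e p') f]_(p, p')` of `f` (Nisan 1991) has entries that are COORDINATES of the
coefficient vector of `f` (`|p + e p'| = |p| + |e p'| ≤ n`), so its determinant is the value at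
`coeff(f)` of ONE polynomial in the `N = C(2n, n)` coefficient variables: the generic determinant
`detPoly rows ℂ` renamed into the coefficient variables `c_(p + e p')`
(`PartitionDeterminantLevel.eval_coeffVector_partDet`, by `eval_rename` + `eval_detPoly`).

* `PartitionDeterminantLevel.card_le_choose_of_degree_le` : stars and bars — any family of exponent
  vectors of degree `≤ n` on `n` variables has at most `C(2n, n)` members (pad with an `(n+1)`-st
  coordinate `n - |m|` — the tree's `Literature.Barriers.Schanuel.degree_cons` — to land injectively
  in `Sym (Fin (n+1)) n`, counted by `Sym.card_sym_eq_choose`); hence `r = #rows ≤ N`.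
* `PartitionDeterminantLevel.complexity_detPoly_fintype_le` : `L(DET_m) ≤ 8 (#m + 1)^7` for any
  finite index type (Berkowitz, the tree's `complexity_detPoly_le`, reindexed by
  `RazDeterminant.rename_detPoly_equiv`).
* `PartitionDeterminantLevel.partDet_mem_distinguishers` : the renamed determinant lies in
  `Distinguishers ℂ n 8`: size `≤ 8 (r+1)^7 ≤ 8 (2N)^7 = 1024 N^7 ≤ N^8` (`N ≥ 2^n ≥ 1024`,
  `LowDegreeEquations.two_pow_le_choose`), degree `≤ r ≤ N ≤ N^8`.
* `stub_partitionDeterminantLevel` : the registered stub, verbatim.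

Mirror of `RazDeterminant.razDet_mem_distinguishers` (p162627) for a different index map. The
hypothesis `2h ≤ n` of the registered signature is not used (the degree bound `|p + e p'| ≤ n` needs
only `2|p| ≤ n`, `2|q| ≤ n`). Axioms: `propext`, `Classical.choice`, `Quot.sound`. No new
definitions (the distinguisher is the term `rename (p, p' ↦ c_(p + e p')) detPoly`).

References: [Berkowitz1984] S. J. Berkowitz, Inform. Process. Lett. 18 (1984) (`DET ∈ VP`);
[Nisan1991Noncommutative] N. Nisan, STOC 1991 (partition / partial-derivative coefficient matrices);
[ForbesShpilkaVolk2018] M. Forbes, A. Shpilka, B. L. Volk, Theory Comput. 14 (2018), §1.2 (rank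
methods are algebraically natural), Cor. 5, Question 6.
-/

-- layout Summits/ValiantsHypothesis/ValiantsHypothesis forces the duplicated namespace component
set_option linter.dupNamespace false

namespace Summit.ValiantsHypothesis.ValiantsHypothesis.Theorems.BarrierLever.SuccinctHittingSetsForVP

open Literature.Barriers.ValiantsHypothesis Literature.Computability.AlgebraicComplexity
open MvPolynomial

namespace PartitionDeterminantLevel

/-- `Finsupp.sum m (fun _ ↦ id)` is the degree `|m|`. [folklore] -/
theorem sum_id_eq_degree {σ : Type*} (m : σ →₀ ℕ) : (m.sum fun _ => id) = m.degree := rfl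

/-- **Stars and bars bound.** A family of exponent vectors of degree `≤ n` on `n` variables has at
most `C(2n, n)` members: `m ↦ (n - |m|, m)` is an injection into the exponent vectors of degree
exactly `n` on `n + 1` variables, i.e. into `Sym (Fin (n+1)) n`, of cardinality
`C(n + 1 + n - 1, n) = C(2n, n)`. [folklore] -/
theorem card_le_choose_of_degree_le {n : ℕ} {P : (Fin n →₀ ℕ) → Prop} [Fintype {m // P m}]
    (hP : ∀ m, P m → m.degree ≤ n) : Fintype.card {m // P m} ≤ (2 * n).choose n := by
  classical
  let ι : {m // P m} → Sym (Fin (n + 1)) n := fun m =>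
    (Sym.equivNatSum (Fin (n + 1)) n).symm
      ⟨Finsupp.cons (n - m.1.degree) m.1, by
        rw [sum_id_eq_degree, Literature.Barriers.Schanuel.degree_cons]
        have := hP m.1 m.2
        omega⟩
  have hι : Function.Injective ι := by
    intro a b hab
    have h1 := Subtype.ext_iff.mp ((Sym.equivNatSum (Fin (n + 1)) n).symm.injective hab)
    have h2 := congrArg Finsupp.tail h1
    simp only [Finsupp.tail_cons] at h2
    exact Subtype.ext h2
  calc Fintype.card {m // P m} ≤ Fintype.card (Sym (Fin (n + 1)) n) :=
        Fintype.card_le_of_injective ι hι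
    _ = (2 * n).choose n := by
        rw [Sym.card_sym_eq_choose, Fintype.card_fin]
        congr 1
        omega

/-- **`L(DET_m) ≤ 8 (#m + 1)^7` for any finite index type** (Berkowitz, via the tree's
`complexity_detPoly_le` and reindexing `RazDeterminant.rename_detPoly_equiv`).
[cite: Berkowitz1984, §2] -/
theorem complexity_detPoly_fintype_le (m : Type*) [Fintype m] [DecidableEq m] :
    complexity (detPoly m ℂ) ≤ 8 * (Fintype.card m + 1) ^ 7 := by
  rw [← RazDeterminant.rename_detPoly_equiv (Fintype.equivFin m).symm]
  exact (complexity_rename_le_holds' _ _).trans (complexity_detPoly_le ℂ _)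

/-- Arithmetic: `8 (r + 1)^7 ≤ N^8` when `r ≤ N` and `N ≥ 1024`. [folklore] -/
theorem size_arith {r N : ℕ} (hr : r ≤ N) (hN : 1024 ≤ N) : 8 * (r + 1) ^ 7 ≤ N ^ 8 := by
  calc 8 * (r + 1) ^ 7 ≤ 8 * (2 * N) ^ 7 :=
        Nat.mul_le_mul_left 8 (Nat.pow_le_pow_left (by omega) 7)
    _ = 1024 * N ^ 7 := by ring
    _ ≤ N * N ^ 7 := Nat.mul_le_mul_right _ hN
    _ = N ^ 8 := by ring

/-- `1024 = 2^10 ≤ 2^n ≤ C(2n, n)` for `n ≥ 10` (the tree's `two_pow_le_choose`). [folklore] -/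
theorem choose_ge_1024 {n : ℕ} (hn : 10 ≤ n) : 1024 ≤ (2 * n).choose n :=
  calc 1024 = 2 ^ 10 := by norm_num
    _ ≤ 2 ^ n := Nat.pow_le_pow_right (by norm_num) hn
    _ ≤ (2 * n).choose n := LowDegreeEquations.two_pow_le_choose (by omega)

variable {n h : ℕ}

/-- The coefficient coordinate read by the `(p, p')` entry of the partition matrix: the monomial
`p + e p'` has degree `|p| + |e p'| ≤ n/2 + n/2 ≤ n`. [folklore] -/
theorem degree_add_le
    (p : {p : Fin n →₀ ℕ // (∀ i ∈ p.support, (i : ℕ) < h) ∧ 2 * p.degree ≤ n})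
    (q : {q : Fin n →₀ ℕ // (∀ i ∈ q.support, h ≤ (i : ℕ) ∧ (i : ℕ) < 2 * h) ∧ 2 * q.degree ≤ n}) :
    (p.1 + q.1).degree ≤ n := by
  rw [map_add]
  have := p.2.2
  have := q.2.2
  omega

/-- **The partition determinant is a polynomial in the coefficient variables**: the value of
`rename (p, p' ↦ c_(p + e p')) DET_rows` at the coefficient vector of `f` is
`det [coeff_(p + e p') f]_(p, p')` (`eval_rename` + `eval_detPoly`; the entries agree
definitionally, `coeffVector_apply`). [folklore] -/
theorem eval_coeffVector_partDet
    [Fintype {p : Fin n →₀ ℕ // (∀ i ∈ p.support, (i : ℕ) < h) ∧ 2 * p.degree ≤ n}]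
    (e : {p : Fin n →₀ ℕ // (∀ i ∈ p.support, (i : ℕ) < h) ∧ 2 * p.degree ≤ n} ≃
      {q : Fin n →₀ ℕ // (∀ i ∈ q.support, h ≤ (i : ℕ) ∧ (i : ℕ) < 2 * h) ∧ 2 * q.degree ≤ n})
    (f : MvPolynomial (Fin n) ℂ) :
    eval (coeffVector (degLEMonomials n) f)
        (rename (fun pp : {p : Fin n →₀ ℕ // (∀ i ∈ p.support, (i : ℕ) < h) ∧ 2 * p.degree ≤ n} ×
            {p : Fin n →₀ ℕ // (∀ i ∈ p.support, (i : ℕ) < h) ∧ 2 * p.degree ≤ n} =>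
          (⟨pp.1.1 + (e pp.2).1, degree_add_le pp.1 (e pp.2)⟩ : degLEMonomials n))
          (detPoly {p : Fin n →₀ ℕ // (∀ i ∈ p.support, (i : ℕ) < h) ∧ 2 * p.degree ≤ n} ℂ)) =
      (Matrix.of
        fun p p' : {p : Fin n →₀ ℕ // (∀ i ∈ p.support, (i : ℕ) < h) ∧ 2 * p.degree ≤ n} =>
          coeff (p.1 + (e p').1) f).det := by
  rw [eval_rename, eval_detPoly]
  rfl

/-- **The partition determinant is a level-8 distinguisher** for `n ≥ 10`: size
`≤ 8 (r+1)^7 ≤ 1024 N^7 ≤ N^8` (`r = #rows ≤ N = C(2n, n)`, `N ≥ 2^n ≥ 1024`) by Berkowitz and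
renaming, degree `≤ r ≤ N ≤ N^8`. [cite: ForbesShpilkaVolk2018, Cor. 5 and §1.2] -/
theorem partDet_mem_distinguishers (hn : 10 ≤ n)
    [Fintype {p : Fin n →₀ ℕ // (∀ i ∈ p.support, (i : ℕ) < h) ∧ 2 * p.degree ≤ n}]
    (e : {p : Fin n →₀ ℕ // (∀ i ∈ p.support, (i : ℕ) < h) ∧ 2 * p.degree ≤ n} ≃
      {q : Fin n →₀ ℕ // (∀ i ∈ q.support, h ≤ (i : ℕ) ∧ (i : ℕ) < 2 * h) ∧ 2 * q.degree ≤ n}) :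
    rename (fun pp : {p : Fin n →₀ ℕ // (∀ i ∈ p.support, (i : ℕ) < h) ∧ 2 * p.degree ≤ n} ×
            {p : Fin n →₀ ℕ // (∀ i ∈ p.support, (i : ℕ) < h) ∧ 2 * p.degree ≤ n} =>
          (⟨pp.1.1 + (e pp.2).1, degree_add_le pp.1 (e pp.2)⟩ : degLEMonomials n))
        (detPoly {p : Fin n →₀ ℕ // (∀ i ∈ p.support, (i : ℕ) < h) ∧ 2 * p.degree ≤ n} ℂ) ∈
      Distinguishers ℂ n 8 := by
  have hr : Fintype.card {p : Fin n →₀ ℕ // (∀ i ∈ p.support, (i : ℕ) < h) ∧ 2 * p.degree ≤ n} ≤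
      (2 * n).choose n :=
    card_le_choose_of_degree_le
      (P := fun p : Fin n →₀ ℕ => (∀ i ∈ p.support, (i : ℕ) < h) ∧ 2 * p.degree ≤ n)
      fun p hp => by have := hp.2; omega
  have hN : 1024 ≤ (2 * n).choose n := choose_ge_1024 hn
  refine ⟨(complexity_rename_le_holds' _ _).trans
    ((complexity_detPoly_fintype_le _).trans (size_arith hr hN)), ?_⟩
  refine (totalDegree_rename_le _ _).trans ?_
  calc (detPoly {p : Fin n →₀ ℕ // (∀ i ∈ p.support, (i : ℕ) < h) ∧ 2 * p.degree ≤ n} ℂ).totalDegree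
        ≤ Fintype.card {p : Fin n →₀ ℕ // (∀ i ∈ p.support, (i : ℕ) < h) ∧ 2 * p.degree ≤ n} :=
        detPoly_isHomogeneous.totalDegree_le
    _ ≤ (2 * n).choose n := hr
    _ = ((2 * n).choose n) ^ 1 := (pow_one _).symm
    _ ≤ ((2 * n).choose n) ^ 8 := Nat.pow_le_pow_right (by omega) (by norm_num)

end PartitionDeterminantLevel

open PartitionDeterminantLevel

/-- **Registered stub `stub_partitionDeterminantLevel`** (crux stmt-ValiantsHypothesis-14610, line
`registered`, wave 8): NISAN'S PARTITION DETERMINANTS ARE LEVEL-8 DISTINGUISHERS — for `n ≥ 10`,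
`2h ≤ n` and any bijection `e` between the row monomials (`x_0 … x_(h-1)`, degree `≤ n/2`) and the
column monomials (`x_h … x_(2h-1)`, degree `≤ n/2`), some `D ∈ Distinguishers ℂ n 8` computes
`det [coeff_(p + e p') f]_(p, p')` on every coefficient vector: the generic determinant renamed into
the coefficient variables `c_(p + e p')`, of size `≤ 8 (r+1)^7 ≤ N^8` by Berkowitz.
[cite: ForbesShpilkaVolk2018, §1.2 and Question 6] [cite: Berkowitz1984, §2] -/
theorem stub_partitionDeterminantLevel :
    ∀ n h : ℕ, 10 ≤ n → 2 * h ≤ n →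
      ∀ [Fintype {p : Fin n →₀ ℕ // (∀ i ∈ p.support, (i : ℕ) < h) ∧ 2 * p.degree ≤ n}]
        (e : {p : Fin n →₀ ℕ // (∀ i ∈ p.support, (i : ℕ) < h) ∧ 2 * p.degree ≤ n} ≃
          {q : Fin n →₀ ℕ // (∀ i ∈ q.support, h ≤ (i : ℕ) ∧ (i : ℕ) < 2 * h) ∧ 2 * q.degree ≤ n}),
      ∃ D ∈ Distinguishers ℂ n 8,
        ∀ f : MvPolynomial (Fin n) ℂ, MvPolynomial.eval (coeffVector (degLEMonomials n) f) D =
          (Matrix.of fun p p' : {p : Fin n →₀ ℕ // (∀ i ∈ p.support, (i : ℕ) < h) ∧ 2 * p.degree ≤ n} =>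
            MvPolynomial.coeff (p.1 + (e p').1) f).det :=
  fun _ _ hn _ _ e => ⟨_, partDet_mem_distinguishers hn e, eval_coeffVector_partDet e⟩

end Summit.ValiantsHypothesis.ValiantsHypothesis.Theorems.BarrierLever.SuccinctHittingSetsForVP
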